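import Literature.NumberTheory.ComplexMultiplication.CMOrderWeakEquivalenceLocalIsomorphism
import Literature.NumberTheory.ComplexMultiplication.CMOrderRegularLocalRings
import HarnessLib

/-!
# Weak equivalence is decided at the SINGULAR primes: `𝔭`-equivalence (Marseglia, *Local isomorphism classes of
# fractional ideals of orders in étale algebras*, Prop. 3.2 / 3.4 / 3.8) for an arbitrary order — every pair of
# ideals is `𝔭`-equivalent at a regular prime, `I_𝔭 = αJ_𝔭 ⟹ 1 ∈ (I:J)(J:I) + 𝔭 ⟺ 1 ∈ ((I:J)(J:I))_𝔭`, and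
# `1 ∈ (I:J)(J:I) ⟺ I_𝔭 ≅ J_𝔭` for the finitely many `𝔭 ⊇ 𝔣` `⟺ 1 ∈ (I:J)(J:I) + ∏_{𝔭 ⊇ 𝔣} 𝔭`

Family `hodge`, lane `lit-hodgefound` (Track 2 foundations library; seat p15, row g26-#4), topic
`Literature/NumberTheory/ComplexMultiplication`, namespaces `Literature.NumberTheory.ComplexMultiplication.NumberRing`
(§1: any (noetherian) domain `R` with fraction field `K`), `…EndOrder` (§2: the order `𝔯 = endOrder ρ`, any `ρ`, any
degree; conductor `𝔣 = conductorIdeal ρ` of `CMOrderConductor`, «`𝔭` singular `⟺ 𝔣 ⊆ 𝔭`» of `CMOrderRegularPrimes`)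
and `…CMTypeLattice` (§3: the series `𝔯 = endOrder (M_μ)`, where `CMOrderWeakEquivalenceLocalIsomorphism` (g26-#3)
supplies (2) ⟹ (1)).  THEOREMS ONLY: no definition, no instance, no named fact (net Literature debt `0`).

Conventions as in `CMOrderWeakEquivalence` / `CMOrderWeakEquivalenceLocalIsomorphism`: weak equivalence is
`1 ∈ I / J * (J / I)`; `R_𝔭 = Localization.subalgebra.ofField K 𝔭.primeCompl _ ⊆ K`, `I_𝔭 = span R_𝔭 ↑I`; «`I` and
`J` are `𝔭`-equivalent» is read, through Prop. 3.2 (1) ⟺ (2), as `I_𝔭 = x·J_𝔭` for some `x ∈ K^*` (the source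
works with completions; «The original definition … uses localization instead of completion. The two definitions are
equivalent», Remark 3.6 — we use localisations throughout, as `CMOrderLocallyPrincipal`).

## Source, VERBATIM

S. Marseglia, *Local isomorphism classes of fractional ideals of orders in étale algebras*, J. Algebra 673 (2025)
77–102 [Marseglia2025LocalIsomorphism] (arXiv:2311.18571, held `paper:arxiv-2311.18571`):
* chunk p0005 (Lemma 2.2): "`𝔭` is not invertible if and only if `(R:𝒪) ⊆ 𝔭` if and only if `R_𝔭 ⊊ 𝒪_𝔭`."
* chunk p0006 (Def. 3.1 / Prop. 3.2): "We say that two fractional `R`-ideals `I` and `J` are `𝔭`-equivalent if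
  `I_𝔭 ≃ J_𝔭` as `R_𝔭`-modules. Proposition 3.2. … the following statements are equivalent: (1) `I` and `J` are
  `𝔭`-equivalent. (2) There exists a non-zero divisor `α ∈ (I:J)_𝔭` such that `I_𝔭 = αJ_𝔭`. (3)
  `(I:J)_𝔭(J:I)_𝔭 = (I:I)_𝔭`. (4) `1 ∈ (I:J)(J:I) + 𝔭`."
* chunk p0006 (before Def. 3.3; `𝒮₀`): "Denote by `𝒮₀` the subset of `𝒮` consisting of maximal ideals not [sic —
  the proof uses: for `𝔭 ∈ 𝒮 ∖ 𝒮₀`, `R_𝔭 = 𝒪_𝔭`; so `𝒮₀` = the maximal ideals of `𝒮` CONTAINING the conductor]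
  containing the conductor `(R:𝒪)` of `R`. Note that `𝒮₀` is a finite set.  Proposition 3.4. … equivalent: (1) `I`
  and `J` are `𝒮`-equivalent. (2) `1 ∈ (I:J)(J:I) + 𝔭` for every `𝔭` in `𝒮`. (3) `I` and `J` are `𝒮₀`-equivalent.
  (4) `1 ∈ (I:J)(J:I) + 𝔭` for every `𝔭` in `𝒮₀`. (5) `1 ∈ (I:J)(J:I) + ∏_{𝔭 ∈ 𝒮₀} 𝔭.  Proof. … If `𝔭` is in
  `𝒮 ∖ 𝒮₀` then `R_𝔭 = 𝒪_𝔭` by Lemma 2.2, which implies that `I` and `J` are `𝔭`-equivalent."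
* chunk p0006 (Def. 3.5 / Prop. 3.8): "We say that `I` and `J` are weakly equivalent if they are `𝔭`-equivalent
  for every maximal ideal `𝔭` of `R`. … Proposition 3.8. Let `I` and `J` be fractional `R`-ideals. Denote by
  `𝔣 = (R:𝒪)` the conductor of `R`. The following statements are equivalent: (1) `I` and `J` are weakly equivalent.
  (2) `1 ∈ (I:J)(J:I)`. (3) … (4) `I` and `J` are `𝔭`-equivalent for every maximal ideal `𝔭` containing `𝔣`."

## What is formalised

* §1 (any domain) `NumberRing.exists_span_coe_eq_span_singleton_of_isPrincipalIdealRing` (if `R_𝔭` is a PID every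
  fractional ideal is locally principal at `𝔭`), `exists_ne_zero_span_coe_eq_of_isPrincipalIdealRing` (hence any two
  nonzero ideals are `𝔭`-equivalent), **`one_mem_span_coe_div_mul_div_of_span_coe_eq`** (Prop. 3.2 (2) ⟹
  `1 ∈ ((I:J)(J:I))_𝔭`, noetherian `R`), **`one_mem_span_coe_iff_one_mem_add_coeIdeal`** (`1 ∈ N_𝔭 ⟺ 1 ∈ N + 𝔭`
  for a maximal `𝔭`: Prop. 3.2 (4)), `one_mem_add_coeIdeal_of_span_coe_eq` (Prop. 3.2 (2) ⟹ (4)).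
* §2 (`𝔯 = endOrder ρ`) **`EndOrder.exists_span_coe_eq_span_singleton_of_not_conductorIdeal_le`**,
  **`exists_ne_zero_span_coe_eq_of_not_conductorIdeal_le`** («if `𝔭 ∉ 𝒮₀` then … `I` and `J` are
  `𝔭`-equivalent»), **`one_mem_div_mul_div_of_forall_conductorIdeal_le`** (Prop. 3.8 (4) ⟹ (2)),
  `one_mem_div_mul_div_of_forall_conductorIdeal_le_one_mem_add` (Prop. 3.4 (4) ⟹ 1 ∈ (I:J)(J:I)),
  **`one_mem_div_mul_div_of_one_mem_add_prod`** (Prop. 3.4 (5) ⟹ `1 ∈ (I:J)(J:I)`).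
* §3 (`𝔯 = endOrder (M_μ)`) the equivalences **`CMTypeLattice.one_mem_div_mul_div_iff_forall_conductorIdeal_le`**
  (Prop. 3.8 (2) ⟺ (4)), `one_mem_div_mul_div_iff_forall_one_mem_add_coeIdeal` (⟺ Prop. 3.4 (4) for all maximal
  `𝔭 ⊇ 𝔣`), `one_mem_div_mul_div_iff_one_mem_add_prod` (⟺ Prop. 3.4 (5)).
-/

open scoped nonZeroDivisors NumberField
open Module FractionalIdeal NumberField

namespace Literature.NumberTheory.ComplexMultiplication

namespace NumberRing

/-! ## §1 Local principality over a principal local ring; Prop. 3.2 (2) ⟹ (4) ⟺ `1 ∈ ((I:J)(J:I))_𝔭` -/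

section AnyDomain

variable {R : Type*} [CommRing R] [IsDomain R] {K : Type*} [Field K] [Algebra R K] [IsFractionRing R K]

/-- `(𝔞)_𝔭 = 𝔞R_𝔭` read in `K`: the local component of an integral ideal is the image of the ideal `𝔞R_𝔭` of the
ring `R_𝔭` (plumbing). [cite: Marseglia2025LocalIsomorphism, §2 («we denote by `I_𝔭` … a fractional `R_𝔭`-ideal»), p. 5] -/
theorem span_coe_coeIdeal_eq_map (𝔞 : Ideal R) (𝔭 : Ideal R) [𝔭.IsPrime] :
    Submodule.span (Localization.subalgebra.ofField K 𝔭.primeCompl 𝔭.primeCompl_le_nonZeroDivisors)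
        ((𝔞 : FractionalIdeal R⁰ K) : Set K) =
      Submodule.map
        (Algebra.linearMap (Localization.subalgebra.ofField K 𝔭.primeCompl 𝔭.primeCompl_le_nonZeroDivisors) K)
        (Ideal.span (algebraMap R (Localization.subalgebra.ofField K 𝔭.primeCompl 𝔭.primeCompl_le_nonZeroDivisors) ''
          (𝔞 : Set R))) := by
  set A := Localization.subalgebra.ofField K 𝔭.primeCompl 𝔭.primeCompl_le_nonZeroDivisors with hA
  have hset : ((𝔞 : FractionalIdeal R⁰ K) : Set K) = Algebra.linearMap A K '' (algebraMap R A '' (𝔞 : Set R)) := by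
    ext x
    rw [SetLike.mem_coe, mem_coeIdeal, Set.image_image]
    simp only [Algebra.linearMap_apply, ← IsScalarTower.algebraMap_apply, Set.mem_image, SetLike.mem_coe]
  rw [hset, Ideal.span, Submodule.map_span]

/-- **If `R_𝔭` is a principal ideal ring, EVERY fractional ideal is locally principal at `𝔭`: `I_𝔭 = aR_𝔭`**
(`I = d⁻¹𝔞`, `𝔞R_𝔭 = gR_𝔭`; «If `𝔭` is in `𝒮 ∖ 𝒮₀` then `R_𝔭 = 𝒪_𝔭` … which implies that `I` and `J` are
`𝔭`-equivalent»). [cite: Marseglia2025LocalIsomorphism, §3, proof of Prop. 3.4, p. 6]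
[cite: Stevenhagen2008NumberRings, §5 Prop. 5.4 («`R_𝔭` is a discrete valuation ring»), p. 220] -/
theorem exists_span_coe_eq_span_singleton_of_isPrincipalIdealRing (𝔭 : Ideal R) [𝔭.IsPrime]
    (hpir : IsPrincipalIdealRing (Localization.subalgebra.ofField K 𝔭.primeCompl 𝔭.primeCompl_le_nonZeroDivisors))
    (I : FractionalIdeal R⁰ K) :
    ∃ a : K, Submodule.span (Localization.subalgebra.ofField K 𝔭.primeCompl 𝔭.primeCompl_le_nonZeroDivisors)
        (I : Set K) =
      Submodule.span (Localization.subalgebra.ofField K 𝔭.primeCompl 𝔭.primeCompl_le_nonZeroDivisors) {a} := by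
  set A := Localization.subalgebra.ofField K 𝔭.primeCompl 𝔭.primeCompl_le_nonZeroDivisors with hA
  haveI := hpir
  obtain ⟨d, 𝔞, -, hI⟩ := exists_eq_spanSingleton_mul I
  obtain ⟨g, hg⟩ := (IsPrincipalIdealRing.principal (Ideal.span (algebraMap R A '' (𝔞 : Set R)))).principal
  refine ⟨(algebraMap R K d)⁻¹ * (g : K), ?_⟩
  rw [hI, span_coe_mul, span_coe_spanSingleton, span_coe_coeIdeal_eq_map, hg, Submodule.map_span,
    Set.image_singleton, Submodule.span_mul_span, Set.singleton_mul_singleton]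
  rfl

/-- **Over a principal `R_𝔭` any two nonzero ideals are `𝔭`-equivalent: `I_𝔭 = x·J_𝔭`, `x ∈ K^*`.**
[cite: Marseglia2025LocalIsomorphism, §3, proof of Prop. 3.4 («which implies that `I` and `J` are `𝔭`-equivalent»),
p. 6] -/
theorem exists_ne_zero_span_coe_eq_of_isPrincipalIdealRing (𝔭 : Ideal R) [𝔭.IsPrime]
    (hpir : IsPrincipalIdealRing (Localization.subalgebra.ofField K 𝔭.primeCompl 𝔭.primeCompl_le_nonZeroDivisors))
    {I J : FractionalIdeal R⁰ K} (hI : I ≠ 0) (hJ : J ≠ 0) :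
    ∃ x : K, x ≠ 0 ∧
      Submodule.span (Localization.subalgebra.ofField K 𝔭.primeCompl 𝔭.primeCompl_le_nonZeroDivisors) (I : Set K) =
        Submodule.span (Localization.subalgebra.ofField K 𝔭.primeCompl 𝔭.primeCompl_le_nonZeroDivisors) {x} *
          Submodule.span (Localization.subalgebra.ofField K 𝔭.primeCompl 𝔭.primeCompl_le_nonZeroDivisors)
            (J : Set K) := by
  set A := Localization.subalgebra.ofField K 𝔭.primeCompl 𝔭.primeCompl_le_nonZeroDivisors with hA
  obtain ⟨a, ha⟩ := exists_span_coe_eq_span_singleton_of_isPrincipalIdealRing 𝔭 hpir I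
  obtain ⟨b, hb⟩ := exists_span_coe_eq_span_singleton_of_isPrincipalIdealRing 𝔭 hpir J
  -- `a ≠ 0 ≠ b`: each ideal contains a nonzero element
  have hne : ∀ {N : FractionalIdeal R⁰ K} {c : K}, N ≠ 0 →
      Submodule.span A (N : Set K) = Submodule.span A {c} → c ≠ 0 := by
    intro N c hN hc h0
    obtain ⟨y, hy0, hyN⟩ := exists_ne_zero_mem_isInteger hN
    have hy : algebraMap R K y ∈ Submodule.span A (N : Set K) := Submodule.subset_span hyN
    rw [hc, h0, Submodule.span_singleton_eq_bot.2 rfl, Submodule.mem_bot] at hy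
    exact hy0 (IsFractionRing.injective R K (hy.trans (map_zero _).symm))
  have ha0 := hne hI ha
  have hb0 := hne hJ hb
  refine ⟨a * b⁻¹, mul_ne_zero ha0 (inv_ne_zero hb0), ?_⟩
  rw [ha, hb, Submodule.span_mul_span, Set.singleton_mul_singleton, inv_mul_cancel_right₀ hb0]

/-- **PROPOSITION 3.2 (2) ⟹ «`1 ∈ ((I:J)(J:I))_𝔭`»: if `I_𝔭 = x·J_𝔭` then `x ∈ (I_𝔭:J_𝔭) = (I:J)_𝔭`,
`x⁻¹ ∈ (J:I)_𝔭`, so `1 ∈ (I:J)_𝔭(J:I)_𝔭 = ((I:J)(J:I))_𝔭`** (one prime at a time; `R` noetherian, `I`, `J ≠ 0`;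
the all-primes form is `CMOrderWeakEquivalenceLocalIsomorphism.one_mem_div_mul_div_of_forall_exists_span_coe_eq`).
[cite: Marseglia2025LocalIsomorphism, §3 Prop. 3.2 ((2) ⟹ (3)) and the last display, p. 6]
[cite: Marseglia2019, §4 Prop. 4.1 ((1) ⟹ (2)), p. 8] -/
theorem one_mem_span_coe_div_mul_div_of_span_coe_eq [IsNoetherianRing R] {I J : FractionalIdeal R⁰ K}
    (hI : I ≠ 0) (hJ : J ≠ 0) (𝔭 : Ideal R) [𝔭.IsPrime] {x : K}
    (hx : Submodule.span (Localization.subalgebra.ofField K 𝔭.primeCompl 𝔭.primeCompl_le_nonZeroDivisors)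
        (I : Set K) =
      Submodule.span (Localization.subalgebra.ofField K 𝔭.primeCompl 𝔭.primeCompl_le_nonZeroDivisors) {x} *
        Submodule.span (Localization.subalgebra.ofField K 𝔭.primeCompl 𝔭.primeCompl_le_nonZeroDivisors)
          (J : Set K)) :
    (1 : K) ∈ Submodule.span (Localization.subalgebra.ofField K 𝔭.primeCompl 𝔭.primeCompl_le_nonZeroDivisors)
      ((I / J * (J / I) : FractionalIdeal R⁰ K) : Set K) := by
  set A := Localization.subalgebra.ofField K 𝔭.primeCompl 𝔭.primeCompl_le_nonZeroDivisors with hA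
  have hx0 : x ≠ 0 := by
    rintro rfl
    obtain ⟨a, ha0, haI⟩ := exists_ne_zero_mem_isInteger hI
    have ha : algebraMap R K a ∈ Submodule.span A (I : Set K) := Submodule.subset_span haI
    rw [hx, Submodule.span_singleton_eq_bot.2 rfl, Submodule.bot_mul] at ha
    exact ha0 (IsFractionRing.injective R K (((Submodule.mem_bot _).1 ha).trans (map_zero _).symm))
  rw [span_coe_mul, span_coe_div hJ, span_coe_div hI]
  have h1 : x ∈ Submodule.span A (I : Set K) / Submodule.span A (J : Set K) := by
    rw [Submodule.mem_div_iff_forall_mul_mem]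
    intro w hw
    rw [hx]
    exact Submodule.mul_mem_mul (Submodule.mem_span_singleton_self x) hw
  have h2 : x⁻¹ ∈ Submodule.span A (J : Set K) / Submodule.span A (I : Set K) := by
    rw [Submodule.mem_div_iff_forall_mul_mem]
    intro v hv
    rw [hx] at hv
    refine Submodule.mul_induction_on hv (fun a ha w hw ↦ ?_) fun v v' hv hv' ↦ by
      rw [mul_add]; exact Submodule.add_mem _ hv hv'
    obtain ⟨t, rfl⟩ := Submodule.mem_span_singleton.1 ha
    rw [Subalgebra.smul_def, smul_eq_mul, show x⁻¹ * ((t : K) * x * w) = (t : K) * (x⁻¹ * x) * w by ring,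
      inv_mul_cancel₀ hx0, mul_one, ← smul_eq_mul, ← Subalgebra.smul_def]
    exact Submodule.smul_mem _ t hw
  rw [← mul_inv_cancel₀ hx0]
  exact Submodule.mul_mem_mul h1 h2

/-- **PROPOSITION 3.2 (4) ⟺ «`1 ∈ N_𝔭`»: for a fractional ideal `N` and a maximal `𝔭`, `1 ∈ N + 𝔭 ⟺ 1 ∈ N_𝔭`**
(«`L = (N + 𝔭) ∩ R` … `L_𝔭 = R_𝔭`»: `⟸` writes `1 = y/s`, `y ∈ N`, `s ∉ 𝔭`, and `as + b = 1` with `b ∈ 𝔭`; `⟹`: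
`1 = n + b`, and `1 - b ∈ R ∖ 𝔭` is a local unit). [cite: Marseglia2025LocalIsomorphism, §3 Prop. 3.2 ((3) ⟺ (4),
proof), p. 6] -/
theorem one_mem_span_coe_iff_one_mem_add_coeIdeal (N : FractionalIdeal R⁰ K) (𝔭 : Ideal R) [h𝔭 : 𝔭.IsMaximal] :
    (1 : K) ∈ Submodule.span (Localization.subalgebra.ofField K 𝔭.primeCompl 𝔭.primeCompl_le_nonZeroDivisors)
        (N : Set K) ↔
      (1 : K) ∈ N + (𝔭 : FractionalIdeal R⁰ K) := by
  set A := Localization.subalgebra.ofField K 𝔭.primeCompl 𝔭.primeCompl_le_nonZeroDivisors with hA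
  constructor
  · intro h1
    obtain ⟨y, hy, s, hys⟩ := (IsLocalization.mem_span_iff 𝔭.primeCompl).1 h1
    rw [← coeToSet_coeToSubmodule, Submodule.span_eq] at hy
    -- `y = s` in `K`
    have hy_eq : y = algebraMap R K (s : R) := by
      have h := congrArg (fun z : K ↦ algebraMap R K (s : R) * z) hys
      simp only [mul_one] at h
      rw [h, Subalgebra.smul_def, smul_eq_mul, ← mul_assoc, IsScalarTower.algebraMap_apply R A K,
        show ∀ a : A, algebraMap A K a = (a : K) from fun _ ↦ rfl, ← Subalgebra.coe_mul, IsLocalization.mk'_spec',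
        map_one, Subalgebra.coe_one, one_mul]
    obtain ⟨a, b, hb, hab⟩ := h𝔭.exists_inv s.2
    -- `1 = a·s + b ∈ N + 𝔭`
    rw [← mem_coe, coe_add, Submodule.add_eq_sup, Submodule.mem_sup]
    refine ⟨a • y, Submodule.smul_mem _ a hy, algebraMap R K b, (mem_coeIdeal R⁰).2 ⟨b, hb, rfl⟩, ?_⟩
    rw [hy_eq, Algebra.smul_def, ← map_mul, ← map_add, hab, map_one]
  · intro h1
    rw [← mem_coe, coe_add, Submodule.add_eq_sup, Submodule.mem_sup] at h1
    obtain ⟨n, hn, b', hb', hnb⟩ := h1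
    obtain ⟨b, hb, rfl⟩ := (mem_coeIdeal R⁰).1 hb'
    -- `n = 1 - b` with `1 - b ∈ R ∖ 𝔭`, a unit of `R_𝔭`: `1 = (1-b)⁻¹ · n ∈ N_𝔭`
    have h1b : (1 : R) - b ∉ 𝔭 := fun h ↦ h𝔭.ne_top ((Ideal.eq_top_iff_one _).2 (by
      have := Ideal.add_mem _ h hb; rwa [sub_add_cancel] at this))
    have hn_eq : n = algebraMap R K (1 - b) := by rw [map_sub, map_one, ← hnb, add_sub_cancel_right]
    have hunit : ((IsLocalization.mk' A (1 : R) (⟨1 - b, h1b⟩ : 𝔭.primeCompl) : A) : K) *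
        algebraMap R K (1 - b) = 1 := by
      rw [IsScalarTower.algebraMap_apply R A K, show ∀ a : A, algebraMap A K a = (a : K) from fun _ ↦ rfl,
        ← Subalgebra.coe_mul, IsLocalization.mk'_spec, map_one, Subalgebra.coe_one]
    rw [← hunit, ← hn_eq, ← smul_eq_mul, ← Subalgebra.smul_def]
    exact Submodule.smul_mem _ _ (Submodule.subset_span hn)

/-- **PROPOSITION 3.2 (2) ⟹ (4): `I_𝔭 = x·J_𝔭 ⟹ 1 ∈ (I:J)(J:I) + 𝔭`** (`𝔭` maximal, `R` noetherian).
[cite: Marseglia2025LocalIsomorphism, §3 Prop. 3.2 ((2) ⟹ (4)), p. 6] -/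
theorem one_mem_add_coeIdeal_of_span_coe_eq [IsNoetherianRing R] {I J : FractionalIdeal R⁰ K} (hI : I ≠ 0)
    (hJ : J ≠ 0) (𝔭 : Ideal R) [𝔭.IsMaximal] {x : K}
    (hx : Submodule.span (Localization.subalgebra.ofField K 𝔭.primeCompl 𝔭.primeCompl_le_nonZeroDivisors)
        (I : Set K) =
      Submodule.span (Localization.subalgebra.ofField K 𝔭.primeCompl 𝔭.primeCompl_le_nonZeroDivisors) {x} *
        Submodule.span (Localization.subalgebra.ofField K 𝔭.primeCompl 𝔭.primeCompl_le_nonZeroDivisors)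
          (J : Set K)) :
    (1 : K) ∈ I / J * (J / I) + (𝔭 : FractionalIdeal R⁰ K) :=
  (one_mem_span_coe_iff_one_mem_add_coeIdeal _ 𝔭).1 (one_mem_span_coe_div_mul_div_of_span_coe_eq hI hJ 𝔭 hx)

end AnyDomain

end NumberRing

/-! ## §2 The order `𝔯 = endOrder ρ`: regular primes never matter; Prop. 3.8 (4) ⟹ (2), Prop. 3.4 (4)/(5) ⟹ (2) -/

namespace EndOrder

variable {K : Type} [Field K] [NumberField K]
variable {ι : Type} [Fintype ι] [DecidableEq ι] [Nonempty ι] {ρ : K →ₐ[ℚ] Matrix ι ι ℚ}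
variable [IsFractionRing (endOrder ρ) K]

/-- **At a REGULAR prime (`𝔣 ⊄ 𝔭`) every fractional ideal of the order is locally principal: `I_𝔭 = aR_𝔭`**
(«`𝔭` is not invertible if and only if `(R:𝒪) ⊆ 𝔭` if and only if `R_𝔭 ⊊ 𝒪_𝔭`»; for `𝔣 ⊄ 𝔭`, `R_𝔭` is a discrete
valuation ring — `CMOrderRegularPrimes`, `CMOrderRegularLocalRings`). [cite: Marseglia2025LocalIsomorphism, §2
Lemma 2.2 and §3, proof of Prop. 3.4, pp. 5–6] [cite: Stevenhagen2008NumberRings, §5 Prop. 5.4 and §6 («`𝔭` is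
regular `⟺ R_𝔭 = 𝒪_𝔭 ⟺ 𝔭 ∤ 𝔣_R`»), pp. 220, 224] -/
theorem exists_span_coe_eq_span_singleton_of_not_conductorIdeal_le {𝔭 : Ideal (endOrder ρ)} [h𝔭 : 𝔭.IsPrime]
    (h0 : 𝔭 ≠ ⊥) (hreg : ¬ conductorIdeal ρ ≤ 𝔭) (I : FractionalIdeal (endOrder ρ)⁰ K) :
    ∃ a : K, Submodule.span (Localization.subalgebra.ofField K 𝔭.primeCompl 𝔭.primeCompl_le_nonZeroDivisors)
        (I : Set K) =
      Submodule.span (Localization.subalgebra.ofField K 𝔭.primeCompl 𝔭.primeCompl_le_nonZeroDivisors) {a} :=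
  NumberRing.exists_span_coe_eq_span_singleton_of_isPrincipalIdealRing 𝔭
    ((isUnit_coeIdeal_iff_isPrincipalIdealRing (K := K) (𝔭 := 𝔭) h0).1
      ((isUnit_coeIdeal_iff_not_conductorIdeal_le h𝔭 h0).2 hreg)) I

/-- **«If `𝔭` is in `𝒮 ∖ 𝒮₀` then `R_𝔭 = 𝒪_𝔭`, which implies that `I` and `J` are `𝔭`-equivalent»: at a regular
prime any two nonzero ideals of the order satisfy `I_𝔭 = x·J_𝔭`, `x ∈ K^*`.** [cite: Marseglia2025LocalIsomorphism,
§3, proof of Prop. 3.4, p. 6] -/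
theorem exists_ne_zero_span_coe_eq_of_not_conductorIdeal_le {𝔭 : Ideal (endOrder ρ)} [h𝔭 : 𝔭.IsPrime]
    (h0 : 𝔭 ≠ ⊥) (hreg : ¬ conductorIdeal ρ ≤ 𝔭) {I J : FractionalIdeal (endOrder ρ)⁰ K} (hI : I ≠ 0) (hJ : J ≠ 0) :
    ∃ x : K, x ≠ 0 ∧
      Submodule.span (Localization.subalgebra.ofField K 𝔭.primeCompl 𝔭.primeCompl_le_nonZeroDivisors) (I : Set K) =
        Submodule.span (Localization.subalgebra.ofField K 𝔭.primeCompl 𝔭.primeCompl_le_nonZeroDivisors) {x} *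
          Submodule.span (Localization.subalgebra.ofField K 𝔭.primeCompl 𝔭.primeCompl_le_nonZeroDivisors)
            (J : Set K) :=
  NumberRing.exists_ne_zero_span_coe_eq_of_isPrincipalIdealRing 𝔭
    ((isUnit_coeIdeal_iff_isPrincipalIdealRing (K := K) (𝔭 := 𝔭) h0).1
      ((isUnit_coeIdeal_iff_not_conductorIdeal_le h𝔭 h0).2 hreg)) hI hJ

/-- **PROPOSITION 3.8 (4) ⟹ (2): if `I_𝔭 = x_𝔭·J_𝔭` for the (finitely many) maximal ideals `𝔭 ⊇ 𝔣`, then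
`1 ∈ (I:J)(J:I)`** — the regular primes take care of themselves; for the order `𝔯 = endOrder ρ` of a number field
of any degree. [cite: Marseglia2025LocalIsomorphism, §3 Prop. 3.8 ((4) ⟹ (2)) with Prop. 3.4, p. 6]
[cite: Marseglia2019, §4 Prop. 4.1 ((1) ⟹ (2)), p. 8] -/
theorem one_mem_div_mul_div_of_forall_conductorIdeal_le {I J : FractionalIdeal (endOrder ρ)⁰ K} (hI : I ≠ 0)
    (hJ : J ≠ 0)
    (h : ∀ 𝔭 : MaximalSpectrum (endOrder ρ), conductorIdeal ρ ≤ 𝔭.asIdeal → ∃ x : K,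
      Submodule.span (Localization.subalgebra.ofField K 𝔭.asIdeal.primeCompl
          𝔭.asIdeal.primeCompl_le_nonZeroDivisors) (I : Set K) =
        Submodule.span (Localization.subalgebra.ofField K 𝔭.asIdeal.primeCompl
            𝔭.asIdeal.primeCompl_le_nonZeroDivisors) {x} *
          Submodule.span (Localization.subalgebra.ofField K 𝔭.asIdeal.primeCompl
            𝔭.asIdeal.primeCompl_le_nonZeroDivisors) (J : Set K)) :
    (1 : K) ∈ I / J * (J / I) := by
  refine one_mem_div_mul_div_of_forall_exists_span_coe_eq hI hJ fun 𝔭 ↦ ?_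
  by_cases hle : conductorIdeal ρ ≤ 𝔭.asIdeal
  · exact h 𝔭 hle
  · haveI := 𝔭.isMaximal.isPrime
    obtain ⟨x, -, hx⟩ := exists_ne_zero_span_coe_eq_of_not_conductorIdeal_le
      (Ring.ne_bot_of_isMaximal_of_not_isField 𝔭.isMaximal not_isField) hle hI hJ
    exact ⟨x, hx⟩

/-- **PROPOSITION 3.4 (4) ⟹ weak equivalence: if `1 ∈ (I:J)(J:I) + 𝔭` for every maximal `𝔭 ⊇ 𝔣`, then
`1 ∈ (I:J)(J:I)`** (at `𝔭 ⊇ 𝔣` by Prop. 3.2 (4) ⟹ `1 ∈ N_𝔭`; at the regular primes by local principality; then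
(4-3)). [cite: Marseglia2025LocalIsomorphism, §3 Prop. 3.4 ((4) ⟹ (1)) and Prop. 3.8, p. 6] -/
theorem one_mem_div_mul_div_of_forall_one_mem_add_coeIdeal {I J : FractionalIdeal (endOrder ρ)⁰ K} (hI : I ≠ 0)
    (hJ : J ≠ 0)
    (h : ∀ 𝔭 : MaximalSpectrum (endOrder ρ), conductorIdeal ρ ≤ 𝔭.asIdeal →
      (1 : K) ∈ I / J * (J / I) + (𝔭.asIdeal : FractionalIdeal (endOrder ρ)⁰ K)) :
    (1 : K) ∈ I / J * (J / I) := by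
  haveI := CMTypeLattice.isNoetherianRing_endOrder ρ
  rw [← mem_coe, NumberRing.mem_iff_forall_mem_span]
  intro 𝔭
  rw [coeToSet_coeToSubmodule]
  haveI := 𝔭.isMaximal
  by_cases hle : conductorIdeal ρ ≤ 𝔭.asIdeal
  · exact (NumberRing.one_mem_span_coe_iff_one_mem_add_coeIdeal _ 𝔭.asIdeal).2 (h 𝔭 hle)
  · obtain ⟨x, -, hx⟩ := exists_ne_zero_span_coe_eq_of_not_conductorIdeal_le
      (Ring.ne_bot_of_isMaximal_of_not_isField 𝔭.isMaximal not_isField) hle hI hJ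
    exact NumberRing.one_mem_span_coe_div_mul_div_of_span_coe_eq hI hJ 𝔭.asIdeal hx

/-- **PROPOSITION 3.4 (5) ⟹ weak equivalence: `1 ∈ (I:J)(J:I) + ∏_{𝔭 ∈ F} 𝔭 ⟹ 1 ∈ (I:J)(J:I)` for any finite set
`F` of maximal ideals containing all the singular ones** (`𝔭 ⊇ 𝔣`; e.g. `F = {𝔭 ⊇ 𝔣}`, finite by
`CMOrderPrimaryDecomposition.finite_setOf_le`). [cite: Marseglia2025LocalIsomorphism, §3 Prop. 3.4 ((5) ⟹ (4) ⟹ (1)),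
p. 6] -/
theorem one_mem_div_mul_div_of_one_mem_add_prod {I J : FractionalIdeal (endOrder ρ)⁰ K} (hI : I ≠ 0) (hJ : J ≠ 0)
    (F : Finset (MaximalSpectrum (endOrder ρ)))
    (hF : ∀ 𝔭 : MaximalSpectrum (endOrder ρ), conductorIdeal ρ ≤ 𝔭.asIdeal → 𝔭 ∈ F)
    (h : (1 : K) ∈ I / J * (J / I) + ((∏ 𝔭 ∈ F, 𝔭.asIdeal : Ideal (endOrder ρ)) : FractionalIdeal (endOrder ρ)⁰ K)) :
    (1 : K) ∈ I / J * (J / I) := by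
  refine one_mem_div_mul_div_of_forall_one_mem_add_coeIdeal hI hJ fun 𝔭 hle ↦ ?_
  have hprod : (∏ 𝔮 ∈ F, 𝔮.asIdeal : Ideal (endOrder ρ)) ≤ 𝔭.asIdeal :=
    Ideal.prod_le_inf.trans (Finset.inf_le (hF 𝔭 hle))
  rw [← mem_coe, coe_add, Submodule.add_eq_sup, Submodule.mem_sup] at h ⊢
  obtain ⟨n, hn, q, hq, hnq⟩ := h
  exact ⟨n, hn, q, coeIdeal_le_coeIdeal K |>.2 hprod hq, hnq⟩

omit [Nonempty ι] [IsFractionRing (endOrder ρ) K] in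
/-- The easy direction of Prop. 3.2 / 3.4: `1 ∈ (I:J)(J:I) ⟹ 1 ∈ (I:J)(J:I) + 𝔞` for any ideal `𝔞` (monotonicity).
[cite: Marseglia2025LocalIsomorphism, §3 Prop. 3.4 ((1) ⟹ (2), «is clear»), p. 6] -/
theorem one_mem_add_coeIdeal_of_one_mem {N : FractionalIdeal (endOrder ρ)⁰ K} (h : (1 : K) ∈ N)
    (𝔞 : Ideal (endOrder ρ)) : (1 : K) ∈ N + (𝔞 : FractionalIdeal (endOrder ρ)⁰ K) := by
  rw [← mem_coe, coe_add, Submodule.add_eq_sup, Submodule.mem_sup]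
  exact ⟨1, h, 0, Submodule.zero_mem _, add_zero 1⟩

end EndOrder

/-! ## §3 The series `𝔯 = endOrder (M_μ)`: Prop. 3.8 (2) ⟺ (4) and the criteria of Prop. 3.4 as equivalences -/

namespace CMTypeLattice

variable {K : Type} [Field K] [NumberField K]
variable {ι : Type} [Fintype ι] [DecidableEq ι] (μ : Basis ι ℚ K)
variable [IsFractionRing (endOrder (Algebra.leftMulMatrix μ)) K]

/-- **PROPOSITION 3.8 (2) ⟺ (4): WEAK EQUIVALENCE IS DECIDED AT THE SINGULAR PRIMES — `1 ∈ (I:J)(J:I)` iff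
`I_𝔭 = x_𝔭·J_𝔭` (`x_𝔭 ∈ K^*`) for the finitely many maximal ideals `𝔭 ⊇ 𝔣`** of the order `𝔯 = endOrder (M_μ)`
of a number field of any degree. [cite: Marseglia2025LocalIsomorphism, §3 Prop. 3.8 ((2) ⟺ (4)), p. 6]
[cite: Marseglia2019, §4 Prop. 4.1, p. 8] -/
theorem one_mem_div_mul_div_iff_forall_conductorIdeal_le [Nonempty ι]
    {I J : FractionalIdeal (endOrder (Algebra.leftMulMatrix μ))⁰ K} (hI : I ≠ 0) (hJ : J ≠ 0) :
    (1 : K) ∈ I / J * (J / I) ↔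
      ∀ 𝔭 : MaximalSpectrum (endOrder (Algebra.leftMulMatrix μ)),
        EndOrder.conductorIdeal (Algebra.leftMulMatrix μ) ≤ 𝔭.asIdeal → ∃ x : K, x ≠ 0 ∧
          Submodule.span (Localization.subalgebra.ofField K 𝔭.asIdeal.primeCompl
              𝔭.asIdeal.primeCompl_le_nonZeroDivisors) (I : Set K) =
            Submodule.span (Localization.subalgebra.ofField K 𝔭.asIdeal.primeCompl
                𝔭.asIdeal.primeCompl_le_nonZeroDivisors) {x} *
              Submodule.span (Localization.subalgebra.ofField K 𝔭.asIdeal.primeCompl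
                𝔭.asIdeal.primeCompl_le_nonZeroDivisors) (J : Set K) :=
  ⟨fun h1 𝔭 _ ↦ (one_mem_div_mul_div_iff_forall_exists_span_coe_eq μ hI hJ).1 h1 𝔭,
    fun h ↦ EndOrder.one_mem_div_mul_div_of_forall_conductorIdeal_le hI hJ fun 𝔭 hle ↦
      let ⟨x, _, hx⟩ := h 𝔭 hle; ⟨x, hx⟩⟩

/-- **PROPOSITION 3.4 (1) ⟺ (4) with `𝒮` = all maximal ideals: `1 ∈ (I:J)(J:I) ⟺ 1 ∈ (I:J)(J:I) + 𝔭` for every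
maximal `𝔭 ⊇ 𝔣`.** [cite: Marseglia2025LocalIsomorphism, §3 Prop. 3.4 ((1) ⟺ (4)) and Prop. 3.8, p. 6] -/
theorem one_mem_div_mul_div_iff_forall_one_mem_add_coeIdeal [Nonempty ι]
    {I J : FractionalIdeal (endOrder (Algebra.leftMulMatrix μ))⁰ K} (hI : I ≠ 0) (hJ : J ≠ 0) :
    (1 : K) ∈ I / J * (J / I) ↔
      ∀ 𝔭 : MaximalSpectrum (endOrder (Algebra.leftMulMatrix μ)),
        EndOrder.conductorIdeal (Algebra.leftMulMatrix μ) ≤ 𝔭.asIdeal →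
          (1 : K) ∈ I / J * (J / I) + (𝔭.asIdeal : FractionalIdeal (endOrder (Algebra.leftMulMatrix μ))⁰ K) :=
  ⟨fun h1 𝔭 _ ↦ EndOrder.one_mem_add_coeIdeal_of_one_mem h1 𝔭.asIdeal,
    EndOrder.one_mem_div_mul_div_of_forall_one_mem_add_coeIdeal hI hJ⟩

/-- **PROPOSITION 3.4 (1) ⟺ (5): `1 ∈ (I:J)(J:I) ⟺ 1 ∈ (I:J)(J:I) + ∏_{𝔭 ∈ F} 𝔭`** for any finite set `F` of
maximal ideals containing the singular ones — ONE membership test decides weak equivalence.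
[cite: Marseglia2025LocalIsomorphism, §3 Prop. 3.4 ((1) ⟺ (5)) and Prop. 3.8, p. 6] -/
theorem one_mem_div_mul_div_iff_one_mem_add_prod [Nonempty ι]
    {I J : FractionalIdeal (endOrder (Algebra.leftMulMatrix μ))⁰ K} (hI : I ≠ 0) (hJ : J ≠ 0)
    (F : Finset (MaximalSpectrum (endOrder (Algebra.leftMulMatrix μ))))
    (hF : ∀ 𝔭 : MaximalSpectrum (endOrder (Algebra.leftMulMatrix μ)),
      EndOrder.conductorIdeal (Algebra.leftMulMatrix μ) ≤ 𝔭.asIdeal → 𝔭 ∈ F) :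
    (1 : K) ∈ I / J * (J / I) ↔
      (1 : K) ∈ I / J * (J / I) +
        ((∏ 𝔭 ∈ F, 𝔭.asIdeal : Ideal (endOrder (Algebra.leftMulMatrix μ))) :
          FractionalIdeal (endOrder (Algebra.leftMulMatrix μ))⁰ K) :=
  ⟨fun h1 ↦ EndOrder.one_mem_add_coeIdeal_of_one_mem h1 _,
    EndOrder.one_mem_div_mul_div_of_one_mem_add_prod hI hJ F hF⟩

end CMTypeLattice

end Literature.NumberTheory.ComplexMultiplication
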